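import Summits.AtomisticToContinuum.BoseEinsteinCondensation.Theses.BECInsertionVariance
import Literature.MathematicalPhysics.QuantumManyBody.SwapEntropy

/-!
# Birth skeleton (BC3) for the crux `BECInsertionVariance.EntropyFromStructure`
(crux item stmt-AtomisticToContinuum-12064, rank 2 of route `route-AtomisticToContinuum-BECInsertionVariance`;
registered by the skeleton registrar planner-skel-stmt-AtomisticToContinuum-12064-0, 2026-08-17)

Crux (FIXED, by name): `EntropyFromStructure` — for `v`, `0 < ρ < ρ₀(v)` and ANY `C_H, C_L` there is `C` with,
for all large `N = n+1` and `Ψ₀ = groundState v N (N/ρ)^{1/3}`: [Ψ₀ is `C_H`-hyperuniform on `2π/L ≤ |k| ≤ √(ρa)`] →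
[one-body log-Harnack at scale `r = (ρa)^{-1/2}` with constant `C_L`] → [accessible swap mass ≥ 1/2] →
accessible swap (teleportation) entropy `∫_{q≠0} p (log p − log q)⁺ ≤ C` (`p = Ψ₀²⊗Ψ₀²`, `q = p ∘ swap of particle 0`).

THE LINE (the route's own two-layer plan for R — "UV from L, IR from H, deterministic bookkeeping" — typed so that
every piece is a closed statement over tree vocabulary):

* S1 `stub_swapSymmetrisation` (general `Φ`, exact): swap entropy ≤ 2 × ONE-COPY teleportation entropy
  `D₁ = ∫_{acc} p (log Φ(X)² − log Φ(X[0↦y₀])²)⁺` (replica flip symmetry).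
* S2 `stub_coarseGrainingSplit` (general `Φ`, any `r`, exact): with the coarse insertion field
  `V = −log ⨍_{B(·,r)} Φ(X[0↦·])²` (ball average of the conditional DENSITY — zeros of `Φ` cost nothing),
  `D₁ ≤ T_ind + T_coarse + T_typ` (triangle inequality for positive parts through `V(y₀)` and `V(x₀)`).
  In S3–S5 the coarse-graining radius is `r = (max √(ρa) L⁻¹)⁻¹ = min((ρa)^{-1/2}, L)`: the healing length of
  the L-hypothesis (`= 1/k_max` of the H-window) capped at the box side (`= 2π/k_min` up to `2π`); it is `> 0`
  for every admissible `v` (also in the free case `a = 0`, where `(√(ρa))⁻¹` alone would be Lean's junk `0⁻¹ = 0`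
  and the ball empty) and equals `(ρa)^{-1/2}` for all large `N` when `a > 0`.
* S3 `stub_typicalPointLogRegularity` (UV, typical point; from L): `T_typ ≤ C`.
* S4 `stub_insertionPointLogRegularity` (UV, independent insertion point = the tilt): `T_ind ≤ C`.
* S5 `stub_coarseTeleportationWork` (IR heart; from H by linear response, the `k^{d-2}` test): `T_coarse ≤ C`.
* `EntropyFromStructure_of : EntropyFromStructure` — kernel-checked glue using the five stubs BY NAME (the only
  `sorry`s in its cone): `ρ₀ = min`, `C = 2 (C₄⁺ + C₅⁺ + C₃⁺)`, intersect the three eventual sets, chain S1, S2 and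
  the three bounds.

All five stubs are stated over existing declarations only (`groundState`, `sideLength`, `scatteringLength`,
`structureFactorVar`, Mathlib); S3–S5 keep the crux's binder prefix, take the crux's hypothesis bodies VERBATIM
(H for S5, L for S3/S4) and the crux's accessible-mass hypothesis, and conclude about the same `Ψ₀`.
Disproof used: none on file for this crux (`ledger crux ls`: no Disproof.lean; negatives index: no entry for R).
Sorries: exactly the five `stub_*`; nothing else.
-/

namespace Summit.AtomisticToContinuum.BoseEinsteinCondensation.Cruxes.EntropyFromStructure.Birth

open Summit.AtomisticToContinuum.BoseEinsteinCondensation.Theses.BECInsertionVariance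
open MeasureTheory Filter

/-- stub S1 — SWAP SYMMETRISATION (general measurable real `Φ`, exact, size M). On `{q ≠ 0}` the
swap log-ratio splits as `log p − log q = [log Φ(X)² − log Φ(X[0↦y₀])²] + [log Φ(Y)² − log Φ(Y[0↦x₀])²]`,
the two halves are exchanged by the measure-preserving replica flip `(X,Y) ↦ (Y,X)`
(`{q ≠ 0}` and `p` are flip-invariant), `ofReal` is subadditive and `{q ≠ 0} ⊆ {Φ(X[0↦y₀]) ≠ 0}`:
the accessible swap entropy (`swapEntropy_def`) is at most TWICE the ONE-COPY teleportation
entropy `D₁(Φ) = ∫_{Φ(X[0↦y₀]) ≠ 0} p · (log Φ(X)² − log Φ(X[0↦y₀])²)⁺` (one boson of replica 1 moved to the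
position of its twin; replica 2 only supplies the law of `y₀`). Tools: `lintegral_comp_replicaSwap`,
`Real.log_mul`, `ENNReal.ofReal_add_le`, `lintegral_mono_set` (SwapEntropy.lean). -/
theorem stub_swapSymmetrisation :
    ∀ (n : ℕ) (Φ : Literature.MathematicalPhysics.QuantumManyBody.BoseGas.Config (n + 1) → ℝ), Measurable Φ → (∫⁻ Z in {Z : Literature.MathematicalPhysics.QuantumManyBody.BoseGas.Config (n + 1) × Literature.MathematicalPhysics.QuantumManyBody.BoseGas.Config (n + 1) | Φ (Function.update Z.1 0 (Z.2 0)) ^ 2 * Φ (Function.update Z.2 0 (Z.1 0)) ^ 2 ≠ 0}, ENNReal.ofReal (Φ Z.1 ^ 2 * Φ Z.2 ^ 2 * (Real.log (Φ Z.1 ^ 2 * Φ Z.2 ^ 2) - Real.log (Φ (Function.update Z.1 0 (Z.2 0)) ^ 2 * Φ (Function.update Z.2 0 (Z.1 0)) ^ 2)))) ≤ 2 * ∫⁻ Z in {Z : Literature.MathematicalPhysics.QuantumManyBody.BoseGas.Config (n + 1) × Literature.MathematicalPhysics.QuantumManyBody.BoseGas.Config (n + 1) | Φ (Function.update Z.1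 0 (Z.2 0)) ≠ 0}, ENNReal.ofReal (Φ Z.1 ^ 2 * Φ Z.2 ^ 2 * (Real.log (Φ Z.1 ^ 2) - Real.log (Φ (Function.update Z.1 0 (Z.2 0)) ^ 2))) := by
  sorry

/-- stub S2 — COARSE-GRAINING SPLIT at scale `r` (general measurable real `Φ`, any `r`, exact, size M).
With the ball-averaged conditional mass `m(X, z) = ⨍_{B(0,r)} Φ(X[0 ↦ z+h])² dh` (coarse-graining of the
one-body conditional DENSITY, so zeros of `Φ` — hard cores, the Dirichlet wall — cost nothing) and the
coarse insertion field `V = −log m`, pointwise `U(y₀) − U(x₀) = [U(y₀) − V(y₀)] + [V(y₀) − V(x₀)] + [V(x₀) − U(x₀)]`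
(`U = −log Φ(X[0↦·])²`, an identity of real numbers whatever the junk values), `ofReal` is subadditive and the
restricted lower integral is monotone/subadditive: `D₁ ≤ T_ind + T_coarse + T_typ`, the three one-copy functionals
bounded by stubs S4, S5, S3. Tools: `ENNReal.ofReal_add_le`, `lintegral_add_left` (+ measurability of the
parametric ball integral, `Measurable.lintegral_prod_right`). -/
theorem stub_coarseGrainingSplit :
    ∀ (n : ℕ) (Φ : Literature.MathematicalPhysics.QuantumManyBody.BoseGas.Config (n + 1) → ℝ) (r : ℝ), Measurable Φ → let B : Set Literature.MathematicalPhysics.QuantumManyBody.BoseGas.Space := Metric.ball 0 r; let m : Literature.MathematicalPhysics.QuantumManyBody.BoseGas.Config (n + 1) → Literature.MathematicalPhysics.QuantumManyBody.BoseGas.Space → ℝ := fun X z => ((MeasureTheory.volume B)⁻¹ * ∫⁻ h in B, ENNReal.ofReal (Φ (Function.update X 0 (z + h)) ^ 2)).toReal; let w : Literature.MathematicalPhysics.QuantumManyBody.BoseGas.Config (n + 1) × Literature.MathematicalPhysics.QuantumManyBody.BoseGas.Config (n + 1) → ℝ := fun Z => Φ Z.1 ^ 2 * Φ Z.2 ^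 2; (∫⁻ Z in {Z : Literature.MathematicalPhysics.QuantumManyBody.BoseGas.Config (n + 1) × Literature.MathematicalPhysics.QuantumManyBody.BoseGas.Config (n + 1) | Φ (Function.update Z.1 0 (Z.2 0)) ≠ 0}, ENNReal.ofReal (w Z * (Real.log (Φ Z.1 ^ 2) - Real.log (Φ (Function.update Z.1 0 (Z.2 0)) ^ 2)))) ≤ (∫⁻ Z in {Z : Literature.MathematicalPhysics.QuantumManyBody.BoseGas.Config (n + 1) × Literature.MathematicalPhysics.QuantumManyBody.BoseGas.Config (n + 1) | Φ (Function.update Z.1 0 (Z.2 0)) ≠ 0}, ENNReal.ofReal (w Z * (Real.log (m Z.1 (Z.2 0)) - Real.log (Φ (Function.update Z.1 0 (Z.2 0)) ^ 2)))) + (∫⁻ Z in {Z : Literature.MathematicalPhysics.QuantumManyBody.BoseGas.Config (n + 1) × Literature.MathematicalPhysics.QuantumManyBody.BoseGas.Config (n + 1) | Φ (Function.update Z.1 0 (Z.2 0)) ≠ 0}, ENNReal.ofReal (w Z * (Real.log (m Z.1 (Z.1 0)) - Real.log (m Z.1 (Z.2 0))))) + (∫⁻ Z in {Z : Literature.MathematicalPhysics.QuantumManyBody.BoseGas.Config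 (n + 1) × Literature.MathematicalPhysics.QuantumManyBody.BoseGas.Config (n + 1) | Φ (Function.update Z.1 0 (Z.2 0)) ≠ 0}, ENNReal.ofReal (w Z * (Real.log (Φ Z.1 ^ 2) - Real.log (m Z.1 (Z.1 0))))) := by
  sorry

/-- stub S3 — UV AT THE TYPICAL POINT (the ground state; consumes the log-Harnack hypothesis L; size L).
`T_typ = E_{X∼Ψ₀²}[(log Ψ₀(X)² − log ⨍_{B(x₀,r)} Ψ₀(·,X̂)²)⁺ · (accessible y-mass ≤ 1)]`: how far, in log and on
average, the density at the boson's ACTUAL position exceeds its average over the healing ball `r = min((ρa)^{-1/2}, L)`.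
By concavity of `log`, `log Ψ₀² − log ⨍_B Ψ₀²(X_h) ≤ ⨍_{acc}(log Ψ₀²(X) − log Ψ₀²(X_h)) dh + log(1/accfrac(X))`, so it is
the L-hypothesis (b) (first-moment log-oscillation at the typical point) plus control of the accessible fraction of
the ball (L (a): ≤ 1/4 inaccessible on average; walls: ≥ 1/8 of the ball lies in the box). Near cores and walls the
point value is BELOW the ball average, so the positive part vanishes there. Why it might fail: configurations whose
healing ball is mostly caged by cores (accfrac → 0) must carry small Ψ₀²-weight uniformly in N (a large-deviation
input beyond L (a)). Free case `a = 0` (`r = L`, L vacuous): sine product, point value vs. ball average differ by `O(1)` in mean. -/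
theorem stub_typicalPointLogRegularity :
    ∀ v : ℝ → ENNReal, Literature.MathematicalPhysics.QuantumManyBody.BoseGas.IsRepulsiveFiniteRange v → ∃ ρ₀ : ℝ, 0 < ρ₀ ∧ ∀ ρ : ℝ, 0 < ρ → ρ < ρ₀ → ∀ C_L : ℝ, ∃ C : ℝ, ∀ᶠ n : ℕ in Filter.atTop, (let L : ℝ := Literature.MathematicalPhysics.QuantumManyBody.BoseGas.sideLength ρ (n + 1); let Ψ₀ : Literature.MathematicalPhysics.QuantumManyBody.BoseGas.Config (n + 1) → ℝ := Literature.MathematicalPhysics.QuantumManyBody.BoseGas.groundState v (n + 1) L; let r : ℝ := (Real.sqrt (ρ * (Literature.MathematicalPhysics.QuantumManyBody.BoseGas.scatteringLength v).toReal))⁻¹; let B : Set Literature.MathematicalPhysics.QuantumManyBody.BoseGas.Space := Metric.ball 0 r; let Φ : Literature.MathematicalPhysics.QuantumManyBody.BoseGas.Config (n + 1) × Literature.MathematicalPhysics.QuantumManyBody.BoseGas.Space → ℝ := fun W => Ψ₀ (Function.update W.1 0 (W.1 0 + W.2)); (∫⁻ W in {W | W.2 ∈ B ∧ Φ W = 0},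 ENNReal.ofReal (Ψ₀ W.1 ^ 2)) ≤ 4⁻¹ * MeasureTheory.volume B ∧ (∫⁻ W in {W | W.2 ∈ B ∧ Φ W ≠ 0}, ENNReal.ofReal (|Real.log (Ψ₀ W.1 ^ 2) - Real.log (Φ W ^ 2)| * Ψ₀ W.1 ^ 2)) ≤ ENNReal.ofReal C_L * MeasureTheory.volume B) → (let Ψ₀ : Literature.MathematicalPhysics.QuantumManyBody.BoseGas.Config (n + 1) → ℝ := Literature.MathematicalPhysics.QuantumManyBody.BoseGas.groundState v (n + 1) (Literature.MathematicalPhysics.QuantumManyBody.BoseGas.sideLength ρ (n + 1)); let p : Literature.MathematicalPhysics.QuantumManyBody.BoseGas.Config (n + 1) × Literature.MathematicalPhysics.QuantumManyBody.BoseGas.Config (n + 1) → ℝ := fun Z => Ψ₀ Z.1 ^ 2 * Ψ₀ Z.2 ^ 2; let q : Literature.MathematicalPhysics.QuantumManyBody.BoseGas.Config (n + 1) × Literature.MathematicalPhysics.QuantumManyBody.BoseGas.Config (n + 1) → ℝ := fun Z => Ψ₀ (Function.update Z.1 0 (Z.2 0)) ^ 2 * Ψ₀ (Function.update Z.2 0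 (Z.1 0)) ^ 2; let r : ℝ := (max (Real.sqrt (ρ * (Literature.MathematicalPhysics.QuantumManyBody.BoseGas.scatteringLength v).toReal)) (Literature.MathematicalPhysics.QuantumManyBody.BoseGas.sideLength ρ (n + 1))⁻¹)⁻¹; let B : Set Literature.MathematicalPhysics.QuantumManyBody.BoseGas.Space := Metric.ball 0 r; let m : Literature.MathematicalPhysics.QuantumManyBody.BoseGas.Config (n + 1) → Literature.MathematicalPhysics.QuantumManyBody.BoseGas.Space → ℝ := fun X z => ((MeasureTheory.volume B)⁻¹ * ∫⁻ h in B, ENNReal.ofReal (Ψ₀ (Function.update X 0 (z + h)) ^ 2)).toReal; (1 / 2 : ENNReal) ≤ (∫⁻ Z in {Z | q Z ≠ 0}, ENNReal.ofReal (p Z)) → (∫⁻ Z in {Z : Literature.MathematicalPhysics.QuantumManyBody.BoseGas.Config (n + 1) × Literature.MathematicalPhysics.QuantumManyBody.BoseGas.Config (n + 1) | Ψ₀ (Function.update Z.1 0 (Z.2 0)) ≠ 0}, ENNReal.ofReal (p Z * (Real.log (Ψ₀ Z.1 ^ 2) - Real.log (m Z.1 (Z.1 0))))) ≤ ENNReal.ofReal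 C) := by
  sorry

/-- stub S4 — UV AT THE INDEPENDENT INSERTION POINT, i.e. THE TILT (the ground state; L-hypothesis available; size L).
`T_ind = E_{X̂} ∫ n₁(y) 1[Ψ₀(y,X̂) ≠ 0] (log ⨍_{B(y,r)} Ψ₀(·,X̂)² − log Ψ₀(y,X̂)²)⁺ dy` with `n₁` the normalised one-body
density of the other replica (≈ uniform on the box): anti-concentration of the conditional density at a point that is
NOT tilted toward high density. Large only where `Ψ₀(·,X̂)²` sits far below its local average: within the healing
layer of the wall (`∝ (d/r)² ⇒ 2 log(r/d)`, integrable, volume fraction `r/L → 0`) and at core contact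
(`(1 − a/|y−x_j|)² ⇒` an integrable log-singularity of total weight `≍ N a³/L³ = ρa³`), plus the `O(1)` smooth
fluctuation. This is the term the crux's why-might-fail calls `the tilt n ↔ p_X̂ for the teleported point`: L controls
oscillation around TYPICAL points only; here one needs a one-variable (Moser/log-)Harnack or subsolution estimate for
the conditional amplitude around a UNIFORM point. The L-hypothesis also excludes the super-singular soft cores
(`v = r^{-p}`, `p ≥ 8`, flagged in the crux-attack evidence) for which `T_ind = +∞`. Free case `a = 0` (`r = L`): the
`log(1/d²)` wall singularity against `n₁ ∝ d²` is integrable, `O(1)`. -/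
theorem stub_insertionPointLogRegularity :
    ∀ v : ℝ → ENNReal, Literature.MathematicalPhysics.QuantumManyBody.BoseGas.IsRepulsiveFiniteRange v → ∃ ρ₀ : ℝ, 0 < ρ₀ ∧ ∀ ρ : ℝ, 0 < ρ → ρ < ρ₀ → ∀ C_L : ℝ, ∃ C : ℝ, ∀ᶠ n : ℕ in Filter.atTop, (let L : ℝ := Literature.MathematicalPhysics.QuantumManyBody.BoseGas.sideLength ρ (n + 1); let Ψ₀ : Literature.MathematicalPhysics.QuantumManyBody.BoseGas.Config (n + 1) → ℝ := Literature.MathematicalPhysics.QuantumManyBody.BoseGas.groundState v (n + 1) L; let r : ℝ := (Real.sqrt (ρ * (Literature.MathematicalPhysics.QuantumManyBody.BoseGas.scatteringLength v).toReal))⁻¹; let B : Set Literature.MathematicalPhysics.QuantumManyBody.BoseGas.Space := Metric.ball 0 r; let Φ : Literature.MathematicalPhysics.QuantumManyBody.BoseGas.Config (n + 1) × Literature.MathematicalPhysics.QuantumManyBody.BoseGas.Space → ℝ := fun W => Ψ₀ (Function.update W.1 0 (W.1 0 + W.2)); (∫⁻ W in {W | W.2 ∈ B ∧ Φ W = 0},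 ENNReal.ofReal (Ψ₀ W.1 ^ 2)) ≤ 4⁻¹ * MeasureTheory.volume B ∧ (∫⁻ W in {W | W.2 ∈ B ∧ Φ W ≠ 0}, ENNReal.ofReal (|Real.log (Ψ₀ W.1 ^ 2) - Real.log (Φ W ^ 2)| * Ψ₀ W.1 ^ 2)) ≤ ENNReal.ofReal C_L * MeasureTheory.volume B) → (let Ψ₀ : Literature.MathematicalPhysics.QuantumManyBody.BoseGas.Config (n + 1) → ℝ := Literature.MathematicalPhysics.QuantumManyBody.BoseGas.groundState v (n + 1) (Literature.MathematicalPhysics.QuantumManyBody.BoseGas.sideLength ρ (n + 1)); let p : Literature.MathematicalPhysics.QuantumManyBody.BoseGas.Config (n + 1) × Literature.MathematicalPhysics.QuantumManyBody.BoseGas.Config (n + 1) → ℝ := fun Z => Ψ₀ Z.1 ^ 2 * Ψ₀ Z.2 ^ 2; let q : Literature.MathematicalPhysics.QuantumManyBody.BoseGas.Config (n + 1) × Literature.MathematicalPhysics.QuantumManyBody.BoseGas.Config (n + 1) → ℝ := fun Z => Ψ₀ (Function.update Z.1 0 (Z.2 0)) ^ 2 * Ψ₀ (Function.update Z.2 0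 (Z.1 0)) ^ 2; let r : ℝ := (max (Real.sqrt (ρ * (Literature.MathematicalPhysics.QuantumManyBody.BoseGas.scatteringLength v).toReal)) (Literature.MathematicalPhysics.QuantumManyBody.BoseGas.sideLength ρ (n + 1))⁻¹)⁻¹; let B : Set Literature.MathematicalPhysics.QuantumManyBody.BoseGas.Space := Metric.ball 0 r; let m : Literature.MathematicalPhysics.QuantumManyBody.BoseGas.Config (n + 1) → Literature.MathematicalPhysics.QuantumManyBody.BoseGas.Space → ℝ := fun X z => ((MeasureTheory.volume B)⁻¹ * ∫⁻ h in B, ENNReal.ofReal (Ψ₀ (Function.update X 0 (z + h)) ^ 2)).toReal; (1 / 2 : ENNReal) ≤ (∫⁻ Z in {Z | q Z ≠ 0}, ENNReal.ofReal (p Z)) → (∫⁻ Z in {Z : Literature.MathematicalPhysics.QuantumManyBody.BoseGas.Config (n + 1) × Literature.MathematicalPhysics.QuantumManyBody.BoseGas.Config (n + 1) | Ψ₀ (Function.update Z.1 0 (Z.2 0)) ≠ 0}, ENNReal.ofReal (p Z * (Real.log (m Z.1 (Z.2 0)) - Real.log (Ψ₀ (Function.update Z.1 0 (Z.2 0)) ^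 2)))) ≤ ENNReal.ofReal C) := by
  sorry

/-- stub S5 — IR HEART: HYPERUNIFORMITY ⇒ BOUNDED COARSE-GRAINED TELEPORTATION WORK (the ground state; consumes the
hyperuniformity hypothesis H; size XL, the hardest stub). `T_coarse = E[(V_X̂(y₀) − V_X̂(x₀))⁺]`, `V = −log ⨍_{B(·,r)} Ψ₀(·,X̂)²`
the insertion field coarse-grained at the healing scale `r = (ρa)^{-1/2} = 1/k_max`, compared between an independent
point `y₀ ∼ n₁` and the boson's actual (tilted) position `x₀`. Only modes `2π/L ≤ |k| ≲ 1/r` survive the ball average —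
exactly H's window — and the intended proof is the card's linear-response step: `V̂_X̂(k) = ĥ(k) ρ̂_X̂(k) + r_X̂(k)` with
the Reatto–Chester phonon symbol `|ĥ(k)| ≤ C/|k|` and a summable remainder, so `Var V ≲ (ρ/L³) Σ_k |ĥ(k)|² S_N(k)` with
`N·S_N(k) = structureFactorVar ≤ C_H N |k|/√(ρa)` (H): the `k^{d−2}` integrand, `O(√(ρa³))` in `d = 3`; the tilt of `x₀`
adds the Jeffreys-type bias `≈ Var V_IR`, and `E(·)⁺ ≤ (E(·)²)^{1/2}`. No pointwise logarithm of `Ψ₀` enters (density-level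
coarse-graining), so cores and the wall layer are harmless here (wall layer: `V` larger by `≤ log 16 + O(1)` on an
`n₁`-mass `O(r/L)`). The form-factor-suppressed tail `|k| > 1/r` of the ball average is NOT covered by H's window and needs an
a-priori bound on `S_N(k)` of `Ψ₀` there (or goes into the remainder). Free case `a = 0`: `r = L`, H vacuous, `Ψ₀` = sine
product, `V` varies by `O(1)`. Why it might fail: density waves must be the ONLY infrared channel of the coarse insertion
field (summable remainder `r_X̂`) — verbatim the crux's why-might-fail. -/
theorem stub_coarseTeleportationWork :
    ∀ v : ℝ → ENNReal, Literature.MathematicalPhysics.QuantumManyBody.BoseGas.IsRepulsiveFiniteRange v → ∃ ρ₀ : ℝ, 0 < ρ₀ ∧ ∀ ρ : ℝ, 0 < ρ → ρ < ρ₀ → ∀ C_H : ℝ, ∃ C : ℝ, ∀ᶠ n : ℕ in Filter.atTop, (∀ m : Fin 3 → ℤ, m ≠ 0 → let L : ℝ := Literature.MathematicalPhysics.QuantumManyBody.BoseGas.sideLength ρ (n + 1); let a : ℝ := (Literature.MathematicalPhysics.QuantumManyBody.BoseGas.scatteringLength v).toReal; let k : ℝ := 2 * Real.pi / L * ‖(WithLp.toLp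 2 fun t => (m t : ℝ) : EuclideanSpace ℝ (Fin 3))‖; k ≤ Real.sqrt (ρ * a) → Literature.MathematicalPhysics.QuantumManyBody.BoseGas.structureFactorVar (n + 1) L (fun X => (Literature.MathematicalPhysics.QuantumManyBody.BoseGas.groundState v (n + 1) L X : ℂ)) m ≤ ENNReal.ofReal (C_H * (n + 1) * k / Real.sqrt (ρ * a))) → (let Ψ₀ : Literature.MathematicalPhysics.QuantumManyBody.BoseGas.Config (n + 1) → ℝ := Literature.MathematicalPhysics.QuantumManyBody.BoseGas.groundState v (n + 1) (Literature.MathematicalPhysics.QuantumManyBody.BoseGas.sideLength ρ (n + 1)); let p : Literature.MathematicalPhysics.QuantumManyBody.BoseGas.Config (n + 1) × Literature.MathematicalPhysics.QuantumManyBody.BoseGas.Config (n + 1) → ℝ := fun Z => Ψ₀ Z.1 ^ 2 * Ψ₀ Z.2 ^ 2; let q : Literature.MathematicalPhysics.QuantumManyBody.BoseGas.Config (n + 1) × Literature.MathematicalPhysics.QuantumManyBody.BoseGas.Config (n + 1) → ℝ := fun Z => Ψ₀ (Function.update Z.1 0 (Z.2 0)) ^ 2 * Ψ₀ (Function.update Z.2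 0 (Z.1 0)) ^ 2; let r : ℝ := (max (Real.sqrt (ρ * (Literature.MathematicalPhysics.QuantumManyBody.BoseGas.scatteringLength v).toReal)) (Literature.MathematicalPhysics.QuantumManyBody.BoseGas.sideLength ρ (n + 1))⁻¹)⁻¹; let B : Set Literature.MathematicalPhysics.QuantumManyBody.BoseGas.Space := Metric.ball 0 r; let m : Literature.MathematicalPhysics.QuantumManyBody.BoseGas.Config (n + 1) → Literature.MathematicalPhysics.QuantumManyBody.BoseGas.Space → ℝ := fun X z => ((MeasureTheory.volume B)⁻¹ * ∫⁻ h in B, ENNReal.ofReal (Ψ₀ (Function.update X 0 (z + h)) ^ 2)).toReal; (1 / 2 : ENNReal) ≤ (∫⁻ Z in {Z | q Z ≠ 0}, ENNReal.ofReal (p Z)) → (∫⁻ Z in {Z : Literature.MathematicalPhysics.QuantumManyBody.BoseGas.Config (n + 1) × Literature.MathematicalPhysics.QuantumManyBody.BoseGas.Config (n + 1) | Ψ₀ (Function.update Z.1 0 (Z.2 0)) ≠ 0}, ENNReal.ofReal (p Z * (Real.log (m Z.1 (Z.1 0)) - Real.log (m Z.1 (Z.2 0))))) ≤ ENNReal.ofReal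 C) := by
  sorry

/-- `2·(a⁺… )` bookkeeping in `ℝ≥0∞` for the composition. -/
theorem two_mul_ofReal_add_three {a b c : ℝ} (ha : 0 ≤ a) (hb : 0 ≤ b) (hc : 0 ≤ c) :
    (2 : ENNReal) * (ENNReal.ofReal a + ENNReal.ofReal b + ENNReal.ofReal c) =
      ENNReal.ofReal (2 * (a + b + c)) := by
  rw [← ENNReal.ofReal_add ha hb, ← ENNReal.ofReal_add (add_nonneg ha hb) hc,
    ENNReal.ofReal_mul (by norm_num : (0 : ℝ) ≤ 2), ENNReal.ofReal_ofNat]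

/-- THE COMPOSITION (kernel-checked; its only `sorry`s are the five registered stubs, used BY NAME):
`ρ₀ = min(ρ₃, ρ₄, ρ₅)`, `C = 2 (C₄⁺ + C₅⁺ + C₃⁺)`, intersect the three eventual sets, then
swap entropy ≤ 2·D₁ (S1 at `Φ := Ψ₀`) ≤ 2 (T_ind + T_coarse + T_typ) (S2 at `r = (max √(ρa) L⁻¹)⁻¹`) ≤ ofReal C
(S4, S5, S3). Concludes the crux `EntropyFromStructure` BY NAME. -/
theorem EntropyFromStructure_of : EntropyFromStructure := by
  intro v hv
  obtain ⟨ρ₃, hρ₃, H3⟩ := stub_typicalPointLogRegularity v hv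
  obtain ⟨ρ₄, hρ₄, H4⟩ := stub_insertionPointLogRegularity v hv
  obtain ⟨ρ₅, hρ₅, H5⟩ := stub_coarseTeleportationWork v hv
  refine ⟨min ρ₃ (min ρ₄ ρ₅), lt_min hρ₃ (lt_min hρ₄ hρ₅), fun ρ hρ hρlt C_H C_L => ?_⟩
  have hρ₃' : ρ < ρ₃ := lt_of_lt_of_le hρlt (min_le_left _ _)
  have hρ₄' : ρ < ρ₄ := lt_of_lt_of_le hρlt ((min_le_right _ _).trans (min_le_left _ _))
  have hρ₅' : ρ < ρ₅ := lt_of_lt_of_le hρlt ((min_le_right _ _).trans (min_le_right _ _))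
  obtain ⟨C₃, E3⟩ := H3 ρ hρ hρ₃' C_L
  obtain ⟨C₄, E4⟩ := H4 ρ hρ hρ₄' C_L
  obtain ⟨C₅, E5⟩ := H5 ρ hρ hρ₅' C_H
  refine ⟨2 * (max C₄ 0 + max C₅ 0 + max C₃ 0), ?_⟩
  filter_upwards [E3, E4, E5] with n e3 e4 e5 hH hL Ψ₀ p q hmass
  have i1 := stub_swapSymmetrisation n Ψ₀
    (Literature.MathematicalPhysics.QuantumManyBody.BoseGas.measurable_groundState v (n + 1) (Literature.MathematicalPhysics.QuantumManyBody.BoseGas.sideLength ρ (n + 1)))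
  have i2 := stub_coarseGrainingSplit n Ψ₀
    (max (Real.sqrt (ρ * (Literature.MathematicalPhysics.QuantumManyBody.BoseGas.scatteringLength v).toReal)) (Literature.MathematicalPhysics.QuantumManyBody.BoseGas.sideLength ρ (n + 1))⁻¹)⁻¹
    (Literature.MathematicalPhysics.QuantumManyBody.BoseGas.measurable_groundState v (n + 1) (Literature.MathematicalPhysics.QuantumManyBody.BoseGas.sideLength ρ (n + 1)))
  have i3 := e3 hL hmass
  have i4 := e4 hL hmass
  have i5 := e5 hH hmass
  refine le_trans i1 ?_
  refine le_trans (mul_le_mul_right i2 2) ?_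
  refine le_trans (mul_le_mul_right (add_le_add (add_le_add
    (le_trans i4 (ENNReal.ofReal_le_ofReal (le_max_left C₄ 0)))
    (le_trans i5 (ENNReal.ofReal_le_ofReal (le_max_left C₅ 0))))
    (le_trans i3 (ENNReal.ofReal_le_ofReal (le_max_left C₃ 0)))) 2) ?_
  exact (two_mul_ofReal_add_three (le_max_right C₄ 0) (le_max_right C₅ 0) (le_max_right C₃ 0)).le

end Summit.AtomisticToContinuum.BoseEinsteinCondensation.Cruxes.EntropyFromStructure.Birth
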